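import Summits.QuantumFields.BalabanUV.Beta.GAN24.ContactGaugeStaircase
import Summits.QuantumFields.BalabanUV.Beta.GAN24.ContactKernelCells
import Summits.QuantumFields.BalabanUV.Beta.GAN24.RespStepCauchy

/-!
# `BalabanUV.Beta.GAN24.ContactGaugeStaircaseCauchy` — binder row G-an2-4 / (CONV-C), the row owner's CONTACT-TERM ROUTE, step **CT-4b**
# (`gen19/CT4-DESIGN-v0.md` §2 (α)+(δ), §3): THE BOND GAUGE STAIRCASES OF TWO CONSECUTIVE TOWERS, TOP-ALIGNED, DIFFER BY A STAIRCASE WHOSE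
# PER-SCALE LETTERS ARE `θ^k ×` THE UNDIFFERENCED ONES — plus ONE extra finest piece — in exactly the `hψ ∕ hG₁` shapes of the owner's
# `StaircasePairing.abs_pairing_le_sum`, on the TALLER tower's fine lattice.  Part 1 of 2: identities (generic `d`) + parametric letters (`d = 3`);
# part 2 `ContactGaugeStaircaseCauchyPack` packages them at one common rate from `2 ≤ Lc` alone.

NOT IN PRINT; OUR BOOKKEEPING (road-P2 chair `b2b-balaban-gan24-p2`, gen 34; INTENT «CT-4b GAUGE-STAIRCASE-CAUCHY» journal 2026-08-21T19:29Z;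
first refusal leaf-01 ∕ consumer = the owner's CT-4c∕4e).  HONEST FRAMING (cell contract, verbatim): «discharging `BetaPertH` makes Bałaban's UV
stability UNCONDITIONAL — a real constructive-QFT result; it is NOT the continuum limit and NOT the Clay problem.»  HONEST DEPENDENCY (verbatim):
«continuum YM on T⁴ ⇐ BetaPertH ∧ nine spine estimates (0/9 proved); BetaPertH ⇐ (D1) ∧ (D4) ∧ CAP+tail; G-an2-4 gates asym, D1 and NE2/3/4.»

WHAT.  Tower `k` (readout level `0`, source bond `(μ, z)` at level `k+1`) has the bond gauge function
`λ_k u = Psi ρ Lc 0 k (delta1 μ z) u − bmGaugeAt ρ (respStep 1 (Lc^(k+1)) μ z) Lc u = Σ_{s<k+1} G_k s (blk (Lc^s) u)` (leaf-01 g58's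
`ContactGaugeStaircase.gauge_eq_staircase`; `respStep (Lc^0) (Lc^(0+k+1)) = respStep 1 (Lc^(k+1))` is `ContactPartnerLetters.respStep_pow_zero`).
Tower `k+1` lives on the `Lc`-times finer lattice `u′` (`u = blk Lc u′`); TOP-ALIGNED, its level-`(s+1)` piece and tower `k`'s level-`s` piece are rooted
`Lc`-block gauges of two decimated columns ON THE SAME LATTICE, with prefactors `(Lc^{(d+1)(s+1)})⁻¹` vs `(Lc^{(d+1)s})⁻¹` — the currency factor
`Lc^{−(d+1)}` EXACTLY (CT4-DESIGN §4 (iii) displayed) — and the two columns differ by the owner's CT-4a letter `RespStepCauchy.exists_respStep_cauchy`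
(`c·θ^(s+(k−s))`, i.e. `θ^k` UNIFORMLY in the scale).
* §1 (generic `d`, every root): `bmGaugeAt_sub`, `exp_env_mono` (leaf-01 g58's `ContactKernelCells.legAct_delta1_eq` reused); **`gauge_eq_staircase_uniform`** ∕ **`gauge_eq_staircase_zero`** (leaf-01's
  staircase with ONE formula for every piece); **`gauge_refine_eq_staircase`**: `λ_{k+1} u′ − ((Lc:ℝ)^(d+1))⁻¹·λ_k (blk Lc u′) = Σ_{s′<k+2} ΔG s′ (blk (Lc^s′) u′)`,
  `ΔG 0 = −bmGaugeAt ρ (legAct (respStep 1 (Lc^(k+2))) (delta1 μ z)) Lc` (the EXTRA finest piece of the taller tower, (δ)),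
  `ΔG s′ = −(Lc^{(d+1)s′})⁻¹·bmGaugeAt ρ (legAct (respStep (Lc^s′) (Lc^(k+2))) δ − legAct (respStep (Lc^(s′−1)) (Lc^(k+1))) δ) Lc` (`1 ≤ s′`, (α));
  **`gauge_coarse_eq_staircase_fine`** (tower `k`'s staircase, transported, IS a `(k+2)`-staircase on the fine′ lattice with ZERO finest piece);
  (the born alignment `(m+1, k) ↔ (m, k)` — same lattice, no extra piece — is part 2's `gauge_succ_sub_eq_staircase`).
* §2 (`d = 3`, in-block root; PARAMETRIC in leaf-12's (N1) data `C, κ₀` and in CT-4a's data `c, θ, κ₁`): **`abs_bmGaugeAt_respStep_sub_le`** (the differenced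
  twin of leaf-01 g57's `bmGaugeAt_respStep_envelope`), **`abs_gaugePieceDiff_le`** (`1 ≤ s′ ≤ k+1`: letter `8·Lc·(c·θ^k)·(Lc^{5(k+2)})⁻¹·Lc^s′` at rate `κ₁`
  = `θ^k·(c∕C)` × leaf-01's letter of tower `k+1` at the same scale), **`abs_gaugePieceDiff_zero_le`** (the extra finest piece: `8·Lc·C·(Lc^{5(k+2)})⁻¹` at
  rate `κ₀` — NOT small by `θ^k`; its pairing row is the owner's `(k+2)·Lc^{−(k+1)}`, CT4-DESIGN §2 (δ)), **`abs_gaugePieceUp_le`** (the transported pieces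
  carry tower `k+1`'s geometric letters), **`abs_gaugePieceZero_le`** (the one-formula pieces carry leaf-01's letters `8·Lc·C·(Lc^{5(k+1)})⁻¹·Lc^s`).
[folklore] throughout: bookkeeping over leaf-01's `ContactGaugeStaircase` ∕ `DressedLegEnvelope`, an2's `treeGaugeAt_sub'` ∕ `blockMeanAt_sub`, and the
owner's CT-4a BY NAME; 0 `def`, 0 cited facts, 0 `def … : Prop`, 0 sorry.  NO new estimate; discharges NOTHING of hSdev by itself (the owner's CT-4c∕4e
compose it with CT-4d `ContactTentCauchy` ∕ `ContactTentRefine` and the partner letters); 0 wall binders; NEVER «G-an2-4 closed»; NOT (CONV-C) as typed,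
NOT D1, NOT BetaPertH, NOT continuum, NOT Clay.
-/

noncomputable section

open Finset
open scoped BigOperators
open Literature.MathematicalPhysics.QuantumFieldTheory
open Literature.MathematicalPhysics.QuantumFieldTheory.LatticeForm (quo)
open Literature.MathematicalPhysics.QuantumFieldTheory.Balaban1983to89
open Literature.MathematicalPhysics.QuantumFieldTheory.Balaban1983to89.Beta
open B4ContourShift (supNorm supNorm_nonneg)
open AffineAveraging (Form0 Form1 Site box toSite)
open AveragingContours (blk)
open KKTFluctuationKernel (delta1)
open BalabanCompositeJets (respStep)
open Summit.QuantumFields.BalabanUV.Beta.AxialProjectorBlockMean (bmGaugeAt)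
open Summit.QuantumFields.BalabanUV.Beta.BorderedHessian (treeGaugeAt_sub' blockMeanAt_sub)
open Summit.QuantumFields.BalabanUV.Beta.GAN24.Push4Iter (LegFam)
open Summit.QuantumFields.BalabanUV.Beta.GAN24.RespStepBmDecompLegs (legAct)
open Summit.QuantumFields.BalabanUV.Beta.GAN24.RespStepBmDecomp (blk_blk)
open Summit.QuantumFields.BalabanUV.Beta.GAN24.RespStepBmDecompExact (blk_blk_pow)
open Summit.QuantumFields.BalabanUV.Beta.GAN24.RespStepBmDecompPsi (Psi)
open Summit.QuantumFields.BalabanUV.Beta.GAN24.UndressedResponseUnits (inv_cast_pow_pow)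
open Summit.QuantumFields.BalabanUV.Beta.GAN24.DressedLegEnvelope (blk_pow_blk_pow single_eq_delta1 legAct_delta1 abs_bmGaugeAt_le_of_blockwise
  bmGaugeAt_respStep_envelope)
open Summit.QuantumFields.BalabanUV.Beta.GAN24.StaircaseFaces (blk_one)
open Summit.QuantumFields.BalabanUV.Beta.GAN24.ContactGaugeStaircase (gauge_eq_staircase)
open Summit.QuantumFields.BalabanUV.Beta.GAN24.ContactKernelCells (legAct_delta1_eq)

namespace Summit.QuantumFields.BalabanUV.Beta.GAN24.ContactGaugeStaircaseCauchy

variable {d : ℕ} {Lc : ℕ} [NeZero Lc]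

/-! ## §1 The staircase presentations (generic `d`, every root) -/

/-- [folklore] The rooted block-mean gauge is linear in the 1-form: `bmGaugeAt ρ (A − B) N = bmGaugeAt ρ A N − bmGaugeAt ρ B N`
(an2's `treeGaugeAt_sub'` and `blockMeanAt_sub`). -/
theorem bmGaugeAt_sub (ρ : Fin (d + 1) → ℤ) (A B : Form1 (d + 1) ℝ) (N : ℕ) :
    bmGaugeAt ρ (A - B) N = bmGaugeAt ρ A N - bmGaugeAt ρ B N := by
  unfold bmGaugeAt
  rw [treeGaugeAt_sub', blockMeanAt_sub]
  abel

/-- [folklore] Exponential envelopes are monotone in the rate: `κ ≤ κ′`, `0 ≤ x` ⟹ `e^{−κ′x} ≤ e^{−κx}`. -/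
theorem exp_env_mono {κ κ' x : ℝ} (hκ : κ ≤ κ') (hx : 0 ≤ x) : Real.exp (-(κ' * x)) ≤ Real.exp (-(κ * x)) := by
  rw [Real.exp_le_exp, neg_le_neg_iff]
  exact mul_le_mul_of_nonneg_right hκ hx

/-- NOT IN PRINT; OUR BOOKKEEPING.  **THE STAIRCASE WITH ONE FORMULA FOR EVERY PIECE** (generic `d`, every root, every `m k μ z u`):
`Psi ρ Lc m k (delta1 μ z) u − bmGaugeAt ρ (respStep (Lc^m) (Lc^(m+k+1)) μ z) Lc u = Σ_{s<k+1} Gu s (blk (Lc^s) u)`,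
`Gu s y = −((Lc^{(d+1)s})⁻¹ · bmGaugeAt ρ (legAct (respStep (Lc^(m+s)) (Lc^(m+k+1))) (delta1 μ z)) Lc y)` — leaf-01's `gauge_eq_staircase` with its
`s = 0` piece rewritten through leaf-01's `legAct_delta1_eq : legAct r (delta1 μ z) = r μ z` and `(Lc^0)⁻¹ = 1`. -/
theorem gauge_eq_staircase_uniform (ρ : Fin (d + 1) → ℤ) (m k : ℕ) (μ : Fin (d + 1)) (z u : Site (d + 1)) :
    Psi ρ Lc m k (delta1 μ z) u - bmGaugeAt ρ (respStep (d := d) (Lc ^ m) (Lc ^ (m + k + 1)) μ z) Lc u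
      = ∑ s ∈ Finset.range (k + 1),
          (fun (s : ℕ) (y : Site (d + 1)) =>
            -(((Lc : ℝ) ^ ((d + 1) * s))⁻¹ *
              bmGaugeAt ρ (legAct (respStep (d := d) (Lc ^ (m + s)) (Lc ^ (m + k + 1))) (delta1 μ z)) Lc y)) s (blk (Lc ^ s) u) := by
  rw [gauge_eq_staircase]
  refine Finset.sum_congr rfl fun s _ => ?_
  by_cases h : s = 0
  · subst h
    simp only [if_true, mul_zero, pow_zero, inv_one, one_mul, add_zero, legAct_delta1_eq]
  · simp only [h, if_false]

/-- NOT IN PRINT; OUR BOOKKEEPING.  The same at readout level `0`, clean indices: with `λ_k u := Psi ρ Lc 0 k (delta1 μ z) u − bmGaugeAt ρ (respStep 1 (Lc^(k+1)) μ z) Lc u`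
(the cells' bond gauge function; `respStep (Lc^0) (Lc^(0+k+1)) = respStep 1 (Lc^(k+1))` is leaf-01's `ContactPartnerLetters.respStep_pow_zero`),
`λ_k u = Σ_{s<k+1} G_k s (blk (Lc^s) u)`, `G_k s y = −((Lc^{(d+1)s})⁻¹ · bmGaugeAt ρ (legAct (respStep (Lc^s) (Lc^(k+1))) (delta1 μ z)) Lc y)`. -/
theorem gauge_eq_staircase_zero (ρ : Fin (d + 1) → ℤ) (k : ℕ) (μ : Fin (d + 1)) (z u : Site (d + 1)) :
    Psi ρ Lc 0 k (delta1 μ z) u - bmGaugeAt ρ (respStep (d := d) 1 (Lc ^ (k + 1)) μ z) Lc u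
      = ∑ s ∈ Finset.range (k + 1),
          (fun (s : ℕ) (y : Site (d + 1)) =>
            -(((Lc : ℝ) ^ ((d + 1) * s))⁻¹ *
              bmGaugeAt ρ (legAct (respStep (d := d) (Lc ^ s) (Lc ^ (k + 1))) (delta1 μ z)) Lc y)) s (blk (Lc ^ s) u) := by
  have h := gauge_eq_staircase_uniform (Lc := Lc) ρ 0 k μ z u
  simp only [Nat.zero_add, pow_zero] at h
  rw [Nat.zero_add] at h
  exact h

/-- NOT IN PRINT; OUR BOOKKEEPING.  **CT-4b (α)+(δ), THE IDENTITY: THE TWO TOWERS' BOND GAUGE FUNCTIONS, TOP-ALIGNED, DIFFER BY A STAIRCASE ON THE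
FINE′ LATTICE** (generic `d`, every root, every `k μ z u′`): with `λ_k u := Psi ρ Lc 0 k (delta1 μ z) u − bmGaugeAt ρ (respStep 1 (Lc^(k+1)) μ z) Lc u`,
`λ_{k+1} u′ − ((Lc:ℝ)^(d+1))⁻¹·λ_k (blk Lc u′) = Σ_{s′<k+2} ΔG s′ (blk (Lc^s′) u′)`,
`ΔG s′ y = if s′ = 0 then −bmGaugeAt ρ (legAct (respStep 1 (Lc^(k+2))) (delta1 μ z)) Lc y`
`           else −((Lc^{(d+1)s′})⁻¹ · bmGaugeAt ρ (legAct (respStep (Lc^s′) (Lc^(k+2))) (delta1 μ z) − legAct (respStep (Lc^(s′−1)) (Lc^(k+1))) (delta1 μ z)) Lc y)`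
— the taller tower's level-`s′` piece against the shorter tower's level-`(s′−1)` piece on the SAME lattice (`blk (Lc^(s′−1)) (blk Lc u′) = blk (Lc^s′) u′`),
the currency factor `Lc^{−(d+1)}` absorbed EXACTLY, plus the taller tower's extra finest piece `s′ = 0`. -/
theorem gauge_refine_eq_staircase (ρ : Fin (d + 1) → ℤ) (k : ℕ) (μ : Fin (d + 1)) (z u' : Site (d + 1)) :
    (Psi ρ Lc 0 (k + 1) (delta1 μ z) u' - bmGaugeAt ρ (respStep (d := d) 1 (Lc ^ (k + 2)) μ z) Lc u')
      - ((Lc : ℝ) ^ (d + 1))⁻¹ *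
        (Psi ρ Lc 0 k (delta1 μ z) (blk Lc u') - bmGaugeAt ρ (respStep (d := d) 1 (Lc ^ (k + 1)) μ z) Lc (blk Lc u'))
      = ∑ s' ∈ Finset.range (k + 2),
          (fun (s' : ℕ) (y : Site (d + 1)) =>
            if s' = 0 then -bmGaugeAt ρ (legAct (respStep (d := d) 1 (Lc ^ (k + 2))) (delta1 μ z)) Lc y
            else -(((Lc : ℝ) ^ ((d + 1) * s'))⁻¹ *
              bmGaugeAt ρ (legAct (respStep (d := d) (Lc ^ s') (Lc ^ (k + 2))) (delta1 μ z)
                - legAct (respStep (d := d) (Lc ^ (s' - 1)) (Lc ^ (k + 1))) (delta1 μ z)) Lc y)) s' (blk (Lc ^ s') u') := by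
  have h1 := gauge_eq_staircase_zero (Lc := Lc) ρ (k + 1) μ z u'
  rw [show k + 1 + 1 = k + 2 from rfl] at h1
  rw [h1, gauge_eq_staircase_zero (Lc := Lc) ρ k μ z (blk Lc u')]
  rw [Finset.sum_range_succ' _ (k + 1), Finset.sum_range_succ' _ (k + 1), Finset.mul_sum, add_sub_right_comm,
    ← Finset.sum_sub_distrib]
  simp only [Nat.succ_ne_zero, if_false, if_true, pow_zero, mul_zero, inv_one, one_mul, blk_one, Nat.add_sub_cancel]
  refine congrArg₂ (· + ·) (Finset.sum_congr rfl fun s _ => ?_) rfl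
  rw [blk_blk, ← pow_succ', bmGaugeAt_sub, Pi.sub_apply,
    show (d + 1) * (s + 1) = (d + 1) * s + (d + 1) by ring, pow_add, mul_inv]
  ring

/-- NOT IN PRINT; OUR BOOKKEEPING.  **THE SHORTER TOWER's STAIRCASE, TRANSPORTED TO THE FINE′ LATTICE, IS A `(k+2)`-STAIRCASE WITH ZERO FINEST PIECE**
(generic `d`, every root, every `k μ z u′`): `((Lc:ℝ)^(d+1))⁻¹·λ_k (blk Lc u′) = Σ_{s′<k+2} Gup s′ (blk (Lc^s′) u′)`,
`Gup s′ y = if s′ = 0 then 0 else −((Lc^{(d+1)s′})⁻¹ · bmGaugeAt ρ (legAct (respStep (Lc^(s′−1)) (Lc^(k+1))) (delta1 μ z)) Lc y)`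
(the `hψ` shape of the owner's `StaircasePairing.abs_pairing_le_sum` on the taller tower's lattice, `Lc^s′ ∣ Lc^(k+2)`). -/
theorem gauge_coarse_eq_staircase_fine (ρ : Fin (d + 1) → ℤ) (k : ℕ) (μ : Fin (d + 1)) (z u' : Site (d + 1)) :
    ((Lc : ℝ) ^ (d + 1))⁻¹ *
        (Psi ρ Lc 0 k (delta1 μ z) (blk Lc u') - bmGaugeAt ρ (respStep (d := d) 1 (Lc ^ (k + 1)) μ z) Lc (blk Lc u'))
      = ∑ s' ∈ Finset.range (k + 2),
          (fun (s' : ℕ) (y : Site (d + 1)) =>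
            if s' = 0 then (0 : ℝ)
            else -(((Lc : ℝ) ^ ((d + 1) * s'))⁻¹ *
              bmGaugeAt ρ (legAct (respStep (d := d) (Lc ^ (s' - 1)) (Lc ^ (k + 1))) (delta1 μ z)) Lc y)) s' (blk (Lc ^ s') u') := by
  rw [gauge_eq_staircase_zero (Lc := Lc) ρ k μ z (blk Lc u'), Finset.sum_range_succ' _ (k + 1), Finset.mul_sum]
  simp only [Nat.succ_ne_zero, if_false, if_true, add_zero, Nat.add_sub_cancel]
  refine Finset.sum_congr rfl fun s _ => ?_
  rw [blk_blk, ← pow_succ', show (d + 1) * (s + 1) = (d + 1) * s + (d + 1) by ring, pow_add, mul_inv]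
  ring

/-! ## §2 `d = 3`: per-scale letters (parametric in (N1) and in CT-4a) -/

section Four

omit [NeZero Lc] in
/-- [folklore] Nested labels: `blk (Lc^j) (blk Lc (blk (Lc^(s+1)) u′)) = quo (Lc^(s+2+j)) u′`. -/
theorem blk_blk_blk_eq_quo (j s : ℕ) (u' : Site (3 + 1)) :
    blk (Lc ^ j) (blk Lc (blk (Lc ^ (s + 1)) u')) = quo (Lc ^ (s + 2 + j)) u' := by
  rw [blk_blk_pow, blk_pow_blk_pow]
  rfl

/-- NOT IN PRINT; OUR BOOKKEEPING.  **THE ONE-LEVEL ROOTED GAUGE OF THE DIFFERENCE OF TWO TOP-ALIGNED DECIMATED COLUMNS** (`d = 3`, in-block root;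
PARAMETRIC in the owner's CT-4a data `c, θ, κ₁` of `RespStepCauchy.exists_respStep_cauchy`) — the differenced twin of leaf-01 g57's
`DressedLegEnvelope.bmGaugeAt_respStep_envelope`: for ALL `ℓ j μ z y`,
`|bmGaugeAt ρ (legAct (respStep (Lc^(ℓ+1)) (Lc^(ℓ+j+2))) δ_{μz} − legAct (respStep (Lc^ℓ) (Lc^(ℓ+j+1))) δ_{μz}) Lc y| ≤ 8·Lc·(c·θ^(ℓ+j))·(Lc^{5(j+1)})⁻¹·e^{−κ₁‖blk (Lc^j) (blk Lc y) − z‖∞}`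
(leaf-01's blockwise sup form `abs_bmGaugeAt_le_of_blockwise` on the differenced column, whose envelope is CONSTANT on the `Lc`-block the gauge reads). -/
theorem abs_bmGaugeAt_respStep_sub_le {c θ κ₁ : ℝ}
    (hCau : ∀ (s k : ℕ) (μ : Fin (3 + 1)) (z : Site (3 + 1)) (l : Fin (3 + 1)) (w : Site (3 + 1)),
      |respStep (d := 3) (Lc ^ (s + 1)) (Lc ^ (s + k + 2)) μ z l w - respStep (d := 3) (Lc ^ s) (Lc ^ (s + k + 1)) μ z l w|
        ≤ c * θ ^ (s + k) * ((((Lc ^ (k + 1) : ℕ) : ℝ)) ^ (3 + 2))⁻¹ * Real.exp (-(κ₁ * supNorm (quo (Lc ^ (k + 1)) w - z))))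
    {rr : Fin (3 + 1) → ℕ} (hrr : rr ∈ box (3 + 1) Lc) (ℓ j : ℕ) (μ : Fin (3 + 1)) (z : Site (3 + 1)) (y : Site (3 + 1)) :
    |bmGaugeAt (toSite rr) (legAct (respStep (d := 3) (Lc ^ (ℓ + 1)) (Lc ^ (ℓ + j + 2))) (delta1 μ z)
        - legAct (respStep (d := 3) (Lc ^ ℓ) (Lc ^ (ℓ + j + 1))) (delta1 μ z)) Lc y|
      ≤ 8 * (Lc : ℝ) * (c * θ ^ (ℓ + j)) * ((Lc : ℝ) ^ (5 * (j + 1)))⁻¹ *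
          Real.exp (-(κ₁ * supNorm (blk (Lc ^ j) (blk Lc y) - z))) := by
  have hLc : 1 ≤ Lc := Nat.one_le_iff_ne_zero.2 (NeZero.ne Lc)
  have hA : ∀ (κ : Fin (3 + 1)) (w : Site (3 + 1)),
      |(legAct (respStep (d := 3) (Lc ^ (ℓ + 1)) (Lc ^ (ℓ + j + 2))) (delta1 μ z)
          - legAct (respStep (d := 3) (Lc ^ ℓ) (Lc ^ (ℓ + j + 1))) (delta1 μ z)) κ w|
        ≤ (fun q => c * θ ^ (ℓ + j) * ((Lc : ℝ) ^ (5 * (j + 1)))⁻¹ * Real.exp (-(κ₁ * supNorm (blk (Lc ^ j) q - z)))) (blk Lc w) := by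
    intro κ w
    rw [Pi.sub_apply, Pi.sub_apply, legAct_delta1, legAct_delta1]
    have h := hCau ℓ j μ z κ w
    rw [inv_cast_pow_pow] at h
    have e : quo (Lc ^ (j + 1)) w = blk (Lc ^ j) (blk Lc w) := by
      rw [blk_blk, ← pow_succ']
      rfl
    rw [e] at h
    exact h
  have hg := abs_bmGaugeAt_le_of_blockwise (d := 3)
    (S := fun q => c * θ ^ (ℓ + j) * ((Lc : ℝ) ^ (5 * (j + 1)))⁻¹ * Real.exp (-(κ₁ * supNorm (blk (Lc ^ j) q - z)))) hLc hrr hA y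
  refine hg.trans (le_of_eq ?_)
  push_cast
  ring

variable {rr : Fin (3 + 1) → ℕ}

/-- NOT IN PRINT; OUR BOOKKEEPING.  **(α) THE DIFFERENCED PIECES CARRY `θ^k ×` THE UNDIFFERENCED LETTERS** (`d = 3`, in-block root; PARAMETRIC in CT-4a's
`c, θ, κ₁`): for `1 ≤ s′ ≤ k+1` and every fine′ site `u′`,
`|ΔG s′ (blk (Lc^s′) u′)| ≤ (8·Lc·(c·θ^k)·(Lc^{5(k+2)})⁻¹·Lc^s′)·e^{−κ₁‖quo (Lc^(k+2)) u′ − z‖∞}` (`ΔG` of `gauge_refine_eq_staircase`) — CT-4a at base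
`s′−1`, relative height `k+1−(s′−1)`, hence rate `θ^((s′−1)+(k+1−s′)) = θ^k` UNIFORMLY in the scale; power count `Lc^{−4s′}·Lc^{−5(k+2−s′)} = Lc^{s′}·Lc^{−5(k+2)}`. -/
theorem abs_gaugePieceDiff_le {c θ κ₁ : ℝ}
    (hCau : ∀ (s k : ℕ) (μ : Fin (3 + 1)) (z : Site (3 + 1)) (l : Fin (3 + 1)) (w : Site (3 + 1)),
      |respStep (d := 3) (Lc ^ (s + 1)) (Lc ^ (s + k + 2)) μ z l w - respStep (d := 3) (Lc ^ s) (Lc ^ (s + k + 1)) μ z l w|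
        ≤ c * θ ^ (s + k) * ((((Lc ^ (k + 1) : ℕ) : ℝ)) ^ (3 + 2))⁻¹ * Real.exp (-(κ₁ * supNorm (quo (Lc ^ (k + 1)) w - z))))
    (hrr : rr ∈ box (3 + 1) Lc) (k : ℕ) (μ : Fin (3 + 1)) (z : Site (3 + 1)) {s' : ℕ} (hs1 : 1 ≤ s') (hs : s' ≤ k + 1)
    (u' : Site (3 + 1)) :
    |(fun (s' : ℕ) (y : Site (3 + 1)) =>
        if s' = 0 then -bmGaugeAt (toSite rr) (legAct (respStep (d := 3) 1 (Lc ^ (k + 2))) (delta1 μ z)) Lc y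
        else -(((Lc : ℝ) ^ ((3 + 1) * s'))⁻¹ *
          bmGaugeAt (toSite rr) (legAct (respStep (d := 3) (Lc ^ s') (Lc ^ (k + 2))) (delta1 μ z)
            - legAct (respStep (d := 3) (Lc ^ (s' - 1)) (Lc ^ (k + 1))) (delta1 μ z)) Lc y)) s' (blk (Lc ^ s') u')|
      ≤ 8 * (Lc : ℝ) * (c * θ ^ k) * ((Lc : ℝ) ^ (5 * (k + 2)))⁻¹ * (Lc : ℝ) ^ s' *
          Real.exp (-(κ₁ * supNorm (quo (Lc ^ (k + 2)) u' - z))) := by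
  have hL0 : (0 : ℝ) < Lc := by exact_mod_cast Nat.pos_of_ne_zero (NeZero.ne Lc)
  obtain ⟨s, rfl⟩ : ∃ s, s' = s + 1 := ⟨s' - 1, by omega⟩
  have hsk : s ≤ k := by omega
  simp only [Nat.succ_ne_zero, if_false, abs_neg, Nat.add_sub_cancel]
  have hg := abs_bmGaugeAt_respStep_sub_le (Lc := Lc) hCau hrr s (k - s) μ z (blk (Lc ^ (s + 1)) u')
  rw [show s + (k - s) + 2 = k + 2 by omega, show s + (k - s) + 1 = k + 1 by omega, show s + (k - s) = k by omega,
    blk_blk_blk_eq_quo, show s + 2 + (k - s) = k + 2 by omega] at hg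
  rw [abs_mul, abs_inv, abs_pow, abs_of_pos hL0]
  calc ((Lc : ℝ) ^ ((3 + 1) * (s + 1)))⁻¹ * |bmGaugeAt (toSite rr)
          (legAct (respStep (d := 3) (Lc ^ (s + 1)) (Lc ^ (k + 2))) (delta1 μ z)
            - legAct (respStep (d := 3) (Lc ^ s) (Lc ^ (k + 1))) (delta1 μ z)) Lc (blk (Lc ^ (s + 1)) u')|
      ≤ ((Lc : ℝ) ^ ((3 + 1) * (s + 1)))⁻¹ *
          (8 * (Lc : ℝ) * (c * θ ^ k) * ((Lc : ℝ) ^ (5 * (k - s + 1)))⁻¹ *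
            Real.exp (-(κ₁ * supNorm (quo (Lc ^ (k + 2)) u' - z)))) :=
        mul_le_mul_of_nonneg_left hg (by positivity)
    _ = 8 * (Lc : ℝ) * (c * θ ^ k) * ((Lc : ℝ) ^ (5 * (k + 2)))⁻¹ * (Lc : ℝ) ^ (s + 1) *
          Real.exp (-(κ₁ * supNorm (quo (Lc ^ (k + 2)) u' - z))) := by
        have e : (Lc : ℝ) ^ (5 * (k + 2))
            = (Lc : ℝ) ^ ((3 + 1) * (s + 1)) * (Lc : ℝ) ^ (5 * (k - s + 1)) * (Lc : ℝ) ^ (s + 1) := by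
          rw [← pow_add, ← pow_add]
          congr 1
          omega
        rw [e]
        field_simp

/-- NOT IN PRINT; OUR BOOKKEEPING.  **(δ) THE EXTRA FINEST PIECE OF THE TALLER TOWER** (`d = 3`, in-block root; PARAMETRIC in leaf-12's (N1) `C, κ₀`):
`|ΔG 0 u′| ≤ 8·Lc·C·(Lc^{5(k+2)})⁻¹·e^{−κ₀‖quo (Lc^(k+2)) u′ − z‖∞}` — leaf-01's letter of tower `k+1` at scale `0`, NOT small by `θ^k` (its row of the
owner's pairing weights is `(k+2)·Lc^{−(k+1)}` relative: CT4-DESIGN §2 (δ)). -/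
theorem abs_gaugePieceDiff_zero_le {κ₀ C : ℝ}
    (hN1 : ∀ (m k : ℕ) (μ : Fin (3 + 1)) (z : Site (3 + 1)) (l'' : Fin (3 + 1)) (w' : Site (3 + 1)),
      |respStep (d := 3) (Lc ^ m) (Lc ^ (m + k + 1)) μ z l'' w'| ≤
        C * ((Lc : ℝ) ^ (5 * (k + 1)))⁻¹ * Real.exp (-(κ₀ * supNorm (quo (Lc ^ (k + 1)) w' - z))))
    (hrr : rr ∈ box (3 + 1) Lc) (k : ℕ) (μ : Fin (3 + 1)) (z : Site (3 + 1)) (u' : Site (3 + 1)) :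
    |(fun (s' : ℕ) (y : Site (3 + 1)) =>
        if s' = 0 then -bmGaugeAt (toSite rr) (legAct (respStep (d := 3) 1 (Lc ^ (k + 2))) (delta1 μ z)) Lc y
        else -(((Lc : ℝ) ^ ((3 + 1) * s'))⁻¹ *
          bmGaugeAt (toSite rr) (legAct (respStep (d := 3) (Lc ^ s') (Lc ^ (k + 2))) (delta1 μ z)
            - legAct (respStep (d := 3) (Lc ^ (s' - 1)) (Lc ^ (k + 1))) (delta1 μ z)) Lc y)) 0 (blk (Lc ^ 0) u')|
      ≤ 8 * (Lc : ℝ) * C * ((Lc : ℝ) ^ (5 * (k + 2)))⁻¹ * Real.exp (-(κ₀ * supNorm (quo (Lc ^ (k + 2)) u' - z))) := by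
  simp only [if_true, pow_zero, blk_one, abs_neg]
  rw [← single_eq_delta1]
  have hg := bmGaugeAt_respStep_envelope (Lc := Lc) hN1 hrr 0 (k + 1) (k + 2) (by ring) μ z u'
  rw [pow_zero] at hg
  have hlab : blk (Lc ^ (k + 1)) (blk Lc u') = quo (Lc ^ (k + 2)) u' := by
    rw [blk_blk, ← pow_succ']
    rfl
  rw [hlab] at hg
  exact hg

/-- NOT IN PRINT; OUR BOOKKEEPING.  **THE TRANSPORTED PIECES CARRY THE TALLER TOWER's GEOMETRIC LETTERS** (`d = 3`, in-block root; PARAMETRIC in (N1) `C, κ₀`):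
for every `s′ ≤ k+1` and every `u′`, `|Gup s′ (blk (Lc^s′) u′)| ≤ (8·Lc·C·(Lc^{5(k+2)})⁻¹·Lc^s′)·e^{−κ₀‖quo (Lc^(k+2)) u′ − z‖∞}` (`Gup` of
`gauge_coarse_eq_staircase_fine`; the `s′ = 0` piece is `0`) — the SAME letters as leaf-01's `abs_gaugePiece_le` for tower `k+1` itself
(`Lc^{−4}·α_k·Lc^{s′−1} = α_{k+1}·Lc^{s′}`). -/
theorem abs_gaugePieceUp_le {κ₀ C : ℝ} (hC : 0 ≤ C)
    (hN1 : ∀ (m k : ℕ) (μ : Fin (3 + 1)) (z : Site (3 + 1)) (l'' : Fin (3 + 1)) (w' : Site (3 + 1)),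
      |respStep (d := 3) (Lc ^ m) (Lc ^ (m + k + 1)) μ z l'' w'| ≤
        C * ((Lc : ℝ) ^ (5 * (k + 1)))⁻¹ * Real.exp (-(κ₀ * supNorm (quo (Lc ^ (k + 1)) w' - z))))
    (hrr : rr ∈ box (3 + 1) Lc) (k : ℕ) (μ : Fin (3 + 1)) (z : Site (3 + 1)) {s' : ℕ} (hs : s' ≤ k + 1) (u' : Site (3 + 1)) :
    |(fun (s' : ℕ) (y : Site (3 + 1)) =>
        if s' = 0 then (0 : ℝ)
        else -(((Lc : ℝ) ^ ((3 + 1) * s'))⁻¹ *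
          bmGaugeAt (toSite rr) (legAct (respStep (d := 3) (Lc ^ (s' - 1)) (Lc ^ (k + 1))) (delta1 μ z)) Lc y)) s' (blk (Lc ^ s') u')|
      ≤ 8 * (Lc : ℝ) * C * ((Lc : ℝ) ^ (5 * (k + 2)))⁻¹ * (Lc : ℝ) ^ s' * Real.exp (-(κ₀ * supNorm (quo (Lc ^ (k + 2)) u' - z))) := by
  have hL0 : (0 : ℝ) < Lc := by exact_mod_cast Nat.pos_of_ne_zero (NeZero.ne Lc)
  rcases Nat.eq_zero_or_pos s' with h0 | hpos
  · subst h0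
    simp only [if_true, abs_zero]
    positivity
  · obtain ⟨s, rfl⟩ : ∃ s, s' = s + 1 := ⟨s' - 1, by omega⟩
    have hsk : s ≤ k := by omega
    simp only [Nat.succ_ne_zero, if_false, abs_neg, Nat.add_sub_cancel]
    rw [← single_eq_delta1]
    have hg := bmGaugeAt_respStep_envelope (Lc := Lc) hN1 hrr s (k - s) (k + 1) (by omega) μ z (blk (Lc ^ (s + 1)) u')
    rw [blk_blk_blk_eq_quo, show s + 2 + (k - s) = k + 2 by omega] at hg
    rw [abs_mul, abs_inv, abs_pow, abs_of_pos hL0]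
    calc ((Lc : ℝ) ^ ((3 + 1) * (s + 1)))⁻¹ * |bmGaugeAt (toSite rr)
            (legAct (respStep (d := 3) (Lc ^ s) (Lc ^ (k + 1)))
              (fun μ' y => if μ' = μ then (if y = z then (1 : ℝ) else 0) else 0)) Lc (blk (Lc ^ (s + 1)) u')|
        ≤ ((Lc : ℝ) ^ ((3 + 1) * (s + 1)))⁻¹ *
            (8 * (Lc : ℝ) * C * ((Lc : ℝ) ^ (5 * (k - s + 1)))⁻¹ * Real.exp (-(κ₀ * supNorm (quo (Lc ^ (k + 2)) u' - z)))) :=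
          mul_le_mul_of_nonneg_left hg (by positivity)
      _ = 8 * (Lc : ℝ) * C * ((Lc : ℝ) ^ (5 * (k + 2)))⁻¹ * (Lc : ℝ) ^ (s + 1) *
            Real.exp (-(κ₀ * supNorm (quo (Lc ^ (k + 2)) u' - z))) := by
          have e : (Lc : ℝ) ^ (5 * (k + 2))
              = (Lc : ℝ) ^ ((3 + 1) * (s + 1)) * (Lc : ℝ) ^ (5 * (k - s + 1)) * (Lc : ℝ) ^ (s + 1) := by
            rw [← pow_add, ← pow_add]
            congr 1
            omega
          rw [e]
          field_simp

/-- NOT IN PRINT; OUR BOOKKEEPING.  **THE CLEAN-INDEX PIECES CARRY leaf-01's GEOMETRIC LETTERS** (`d = 3`, in-block root; PARAMETRIC in (N1) `C, κ₀`): for every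
`s ≤ k` and `u`, `|G_k s (blk (Lc^s) u)| ≤ (8·Lc·C·(Lc^{5(k+1)})⁻¹·Lc^s)·e^{−κ₀‖quo (Lc^(k+1)) u − z‖∞}` (`G_k` of `gauge_eq_staircase_zero`) — leaf-01 g58's
`abs_gaugePiece_le` for the one-formula piece family. -/
theorem abs_gaugePieceZero_le {κ₀ C : ℝ}
    (hN1 : ∀ (m k : ℕ) (μ : Fin (3 + 1)) (z : Site (3 + 1)) (l'' : Fin (3 + 1)) (w' : Site (3 + 1)),
      |respStep (d := 3) (Lc ^ m) (Lc ^ (m + k + 1)) μ z l'' w'| ≤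
        C * ((Lc : ℝ) ^ (5 * (k + 1)))⁻¹ * Real.exp (-(κ₀ * supNorm (quo (Lc ^ (k + 1)) w' - z))))
    (hrr : rr ∈ box (3 + 1) Lc) (k : ℕ) (μ : Fin (3 + 1)) (z : Site (3 + 1)) {s : ℕ} (hs : s ≤ k) (u : Site (3 + 1)) :
    |(fun (s : ℕ) (y : Site (3 + 1)) =>
        -(((Lc : ℝ) ^ ((3 + 1) * s))⁻¹ *
          bmGaugeAt (toSite rr) (legAct (respStep (d := 3) (Lc ^ s) (Lc ^ (k + 1))) (delta1 μ z)) Lc y)) s (blk (Lc ^ s) u)|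
      ≤ 8 * (Lc : ℝ) * C * ((Lc : ℝ) ^ (5 * (k + 1)))⁻¹ * (Lc : ℝ) ^ s * Real.exp (-(κ₀ * supNorm (quo (Lc ^ (k + 1)) u - z))) := by
  have hL0 : (0 : ℝ) < Lc := by exact_mod_cast Nat.pos_of_ne_zero (NeZero.ne Lc)
  simp only [abs_neg]
  rw [← single_eq_delta1]
  have hg := bmGaugeAt_respStep_envelope (Lc := Lc) hN1 hrr s (k - s) (k + 1) (by omega) μ z (blk (Lc ^ s) u)
  have hlab : blk (Lc ^ (k - s)) (blk Lc (blk (Lc ^ s) u)) = quo (Lc ^ (k + 1)) u := by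
    rw [blk_blk_pow, blk_pow_blk_pow, show s + 1 + (k - s) = k + 1 by omega]
    rfl
  rw [hlab] at hg
  rw [abs_mul, abs_inv, abs_pow, abs_of_pos hL0]
  calc ((Lc : ℝ) ^ ((3 + 1) * s))⁻¹ * |bmGaugeAt (toSite rr)
          (legAct (respStep (d := 3) (Lc ^ s) (Lc ^ (k + 1)))
            (fun μ' y => if μ' = μ then (if y = z then (1 : ℝ) else 0) else 0)) Lc (blk (Lc ^ s) u)|
      ≤ ((Lc : ℝ) ^ ((3 + 1) * s))⁻¹ *
          (8 * (Lc : ℝ) * C * ((Lc : ℝ) ^ (5 * (k - s + 1)))⁻¹ * Real.exp (-(κ₀ * supNorm (quo (Lc ^ (k + 1)) u - z)))) :=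
        mul_le_mul_of_nonneg_left hg (by positivity)
    _ = 8 * (Lc : ℝ) * C * ((Lc : ℝ) ^ (5 * (k + 1)))⁻¹ * (Lc : ℝ) ^ s * Real.exp (-(κ₀ * supNorm (quo (Lc ^ (k + 1)) u - z))) := by
        have e : (Lc : ℝ) ^ (5 * (k + 1)) = (Lc : ℝ) ^ ((3 + 1) * s) * (Lc : ℝ) ^ (5 * (k - s + 1)) * (Lc : ℝ) ^ s := by
          rw [← pow_add, ← pow_add]
          congr 1
          omega
        rw [e]
        field_simp

end Four

end Summit.QuantumFields.BalabanUV.Beta.GAN24.ContactGaugeStaircaseCauchy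

end
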